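import Summits.QuantumFields.YangMills.Theorems.AlphaInputsT3ACv3LinearLiftSpread
import HarnessLib

/-!
# `AlphaInputsT3ACv3LinearLiftBiorth` — (LL) STEP L2b-iii: EXACTNESS — THE `k`-FOLD TRANSPORTED-SEGMENT MEAN OF THE SPREAD OF A COARSE 1-FORM RETURNS THE 1-FORM,
# `segIter k (S1 k A) = A` — cell `ym3-torus`, width seat `ym-ust-19936-w2` (g0), OWNER re-point 2026-08-27T23:08Z

WHY.  With `linAvgIter k a = segIter k a − dΨ_k(a)` (`…LinearLiftGauge`) and `linAvgIter k (dg) = d(g ∘ toFine k)`, the lift `a := S1 k A + d(Ψ_k(S1 k A) ∘ coarsen k)` has EXACT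
`k`-fold (0.4)-linear averages `A` as soon as `segIter k (S1 k A) = A`; this file proves that biorthogonality:
* §1 `sum_cellFin_fin` (a cell re-indexed by the corner offset), `runSum_S1` (a straight run of the spread 1-form reads the SUMMED `τ`-profile in the run direction and the
  `σ`-profiles across).
* §2 `blockSum_profiles`, ★★ `segIter_S1 : segIter k (S1 k A) = A` — the flat formula `segIter_apply`, the block parametrised by corner offsets (`sum_iterBlock_eq`), factorisation
  over coordinates (`Finset.prod_univ_sum`), then `Ptau_seg` in the run direction and `Psig_cell` across (`AlphaInputsT3ACv3LinearLiftTorus1D(Seg)`).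
HONEST FRAMING.  Lattice bookkeeping; nothing of [Balaban1987RG1]∕[Balaban1985UV3] asserted; count-neutral helper toward the (FL) row of 2′∕2′χ (`--supports stmt-QuantumFields-19936`);
registry untouched.  YM₃ on the torus is a RUNG of the programme, not the Clay problem; no claim about d = 4, infinite volume or a mass gap.

References: T. Bałaban, Commun. Math. Phys. 109 (1987) 249–301 [Balaban1987RG1] ((0.4)+(0.11) p.253); Commun. Math. Phys. 95 (1984) 17–40 [Balaban1984PropagatorsI] ((1.18) p.20).
-/

set_option autoImplicit false

noncomputable section

namespace Summit.QuantumFields.YangMills.Theorems.LinearLiftSpread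

open Finset
open Literature.MathematicalPhysics.QuantumFieldTheory.Balaban1983to89
open Literature.MathematicalPhysics.QuantumFieldTheory.Balaban1983to89.BlockAveragingEMLProp2 (shiftN_apply)
open Literature.MathematicalPhysics.QuantumFieldTheory.Balaban1983to89.B10Eq47AxialChi (shiftN)
open Literature.MathematicalPhysics.QuantumFieldTheory.Balaban1983to89.B5Eq118OneStroke (iterBlock mem_iterBlock_iff)
open Literature.MathematicalPhysics.QuantumFieldTheory.Balaban1983to89.B5Eq117TorusCarriers (blockSiteK sum_iterBlock_eq)
open Summit.QuantumFields.YangMills.Theorems.AbelianEML (runSum)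
open Summit.QuantumFields.YangMills.Theorems.LinearLiftProfile
open Summit.QuantumFields.YangMills.Theorems.LinearLiftGauge (segIter segIter_apply)

variable {P : Params} (k : ℕ) (hk : k ≤ P.m + P.K)

/-! ## §1 The block as a product of cells; straight runs of the spread 1-form -/

/-- **RE-INDEXING A CELL BY THE CORNER OFFSET**: `Σ_{a ∈ cell c} F(a) = Σ_{t < n} F(c·n + t)`. [folklore] -/
theorem sum_cellFin_fin (h : ℕ) {N₀ Nk : ℕ} [NeZero N₀] [NeZero Nk] (hN' : N₀ = side h * Nk) (n : ℕ) (hn : side h = n) (F : ZMod N₀ → ℝ) (c : ZMod Nk) :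
    ∑ a ∈ (cellFin h c : Finset (ZMod N₀)), F a = ∑ t : Fin n, F (((c.val * n + (t : ℕ) : ℕ)) : ZMod N₀) := by
  subst hn; subst hN'
  have hc := ZMod.val_lt c
  have hCN : c.val * side h + side h ≤ side h * Nk := by
    have : (c.val + 1) * side h ≤ Nk * side h := Nat.mul_le_mul_right _ hc
    rw [Nat.add_mul, one_mul, Nat.mul_comm Nk] at this; exact this
  refine sum_nbij' (fun a => (⟨a.val % side h, Nat.mod_lt _ (side_pos h)⟩ : Fin (side h)))
    (fun t => (((c.val * side h + (t : ℕ) : ℕ)) : ZMod (side h * Nk))) ?_ ?_ ?_ ?_ ?_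
  · intro a _; exact mem_univ _
  · intro t _
    rw [mem_cellFin]
    have hlt : c.val * side h + (t : ℕ) < side h * Nk := by have := t.isLt; omega
    unfold qIdx
    rw [ZMod.val_natCast, Nat.mod_eq_of_lt hlt, Nat.mul_comm, Nat.mul_add_div (side_pos h), Nat.div_eq_of_lt t.isLt, add_zero]
  · intro a ha
    rw [mem_cellFin] at ha
    unfold qIdx at ha
    have e : c.val * side h + a.val % side h = a.val := by
      have := Nat.div_add_mod a.val (side h)
      rw [ha] at this
      linarith [Nat.mul_comm (side h) c.val]
    simp only [e, ZMod.natCast_zmod_val]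
  · intro t _
    apply Fin.ext
    have hlt : c.val * side h + (t : ℕ) < side h * Nk := by have := t.isLt; omega
    simp only [ZMod.val_natCast, Nat.mod_eq_of_lt hlt, Nat.mul_add_mod', Nat.mod_eq_of_lt t.isLt]
  · intro a ha
    rw [mem_cellFin] at ha
    unfold qIdx at ha
    have e : c.val * side h + a.val % side h = a.val := by
      have := Nat.div_add_mod a.val (side h)
      rw [ha] at this
      linarith [Nat.mul_comm (side h) c.val]
    simp only [e, ZMod.natCast_zmod_val]

/-- **A STRAIGHT RUN OF THE SPREAD 1-FORM**: `Σ_{m<L^k} (S1 k A)(x + m e_μ, μ) = Σ_y A(y, μ) · (Σ_m Pτ(x_μ + m, y_μ)) · Π_{i ≠ μ} Pσ(x_i, y_i)` (the run moves only the `μ`-coordinate).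
[cite: Balaban1987RG1, (0.4) p.253] -/
theorem runSum_S1 (A : PBond P k → ℝ) (x : Site P 0) (μ : Fin P.d) :
    runSum (S1 k A) x μ (P.L ^ k) = ∑ y : Site P k, A ⟨y, μ⟩ *
      ((∑ m ∈ range (P.L ^ k), Ptau (hh P k) (x μ + ((m : ℕ) : ZMod (P.sitesPerDir 0))) (y μ)) * ∏ i ∈ univ.erase μ, Psig (hh P k) (x i) (y i)) := by
  unfold runSum S1
  rw [sum_comm]
  refine sum_congr rfl fun y _ => ?_
  rw [sum_mul, mul_sum]
  refine sum_congr rfl fun m _ => ?_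
  dsimp only
  rw [shiftN_apply, if_pos rfl]
  congr 2
  exact prod_congr rfl fun i hi => by rw [shiftN_apply, if_neg (ne_of_mem_erase hi), add_zero]

/-! ## §2 Biorthogonality -/

include hk in
/-- The block sum of the run-direction `τ`-sums times the transverse `σ`-profiles factorises and evaluates: `n^d` if `y = z`, else `0`. [folklore] -/
theorem blockSum_profiles (z y : Site P k) (μ : Fin P.d) :
    ∑ x ∈ iterBlock k z, (∑ m ∈ range (P.L ^ k), Ptau (hh P k) (x μ + ((m : ℕ) : ZMod (P.sitesPerDir 0))) (y μ)) * ∏ i ∈ univ.erase μ, Psig (hh P k) (x i) (y i)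
      = if y = z then ((side (hh P k) : ℝ)) ^ P.d else 0 := by
  have hN' := hN k hk
  -- the summand as a product over all coordinates
  let g : Fin P.d → ZMod (P.sitesPerDir 0) → ℝ := fun i a =>
    if i = μ then ∑ m ∈ range (P.L ^ k), Ptau (hh P k) (a + ((m : ℕ) : ZMod (P.sitesPerDir 0))) (y i) else Psig (hh P k) a (y i)
  have hg : ∀ x : Site P 0, (∑ m ∈ range (P.L ^ k), Ptau (hh P k) (x μ + ((m : ℕ) : ZMod (P.sitesPerDir 0))) (y μ)) * ∏ i ∈ univ.erase μ, Psig (hh P k) (x i) (y i)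
      = ∏ i, g i (x i) := by
    intro x
    rw [← mul_prod_erase univ (fun i => g i (x i)) (mem_univ μ)]
    simp only [g, if_pos rfl]
    congr 1
    exact prod_congr rfl fun i hi => by rw [if_neg (ne_of_mem_erase hi)]
  rw [sum_congr rfl fun x _ => hg x, sum_iterBlock_eq hk]
  -- parametrise the block by the corner offsets and factorise over the coordinates
  let G : Fin P.d → Fin (P.L ^ k) → ℝ := fun i t => g i ((((z i).val * P.L ^ k + (t : ℕ) : ℕ)) : ZMod (P.sitesPerDir 0))
  have hG : ∀ jj : Fin P.d → Fin (P.L ^ k), ∏ i, g i (blockSiteK k z jj i) = ∏ i, G i (jj i) := fun jj => rfl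
  rw [sum_congr rfl fun jj _ => hG jj]
  have hfac : ∑ jj : Fin P.d → Fin (P.L ^ k), ∏ i, G i (jj i) = ∏ i, ∑ t : Fin (P.L ^ k), G i t := by
    rw [Finset.prod_univ_sum, Fintype.piFinset_univ]
  rw [hfac]
  have hcell : ∀ i, ∑ t : Fin (P.L ^ k), G i t = ∑ a ∈ cellFin (hh P k) (z i), g i a :=
    fun i => (sum_cellFin_fin (hh P k) hN' (P.L ^ k) (hside k) (g i) (z i)).symm
  rw [prod_congr rfl fun i _ => hcell i]
  -- each coordinate sum
  have hi : ∀ i, ∑ a ∈ cellFin (hh P k) (z i), g i a = if y i = z i then (side (hh P k) : ℝ) else 0 := by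
    intro i
    by_cases h : i = μ
    · simp only [g, if_pos h]
      rw [← hside (P := P) k]
      exact Ptau_seg (hh P k) hN' (y i) (z i)
    · simp only [g, if_neg h]
      exact Psig_cell (hh P k) hN' (y i) (z i)
  rw [prod_congr rfl fun i _ => hi i]
  by_cases hyz : y = z
  · subst hyz
    simp only [if_true]
    rw [prod_const, card_univ, Fintype.card_fin]
  · rw [if_neg hyz]
    obtain ⟨i, hi'⟩ : ∃ i, y i ≠ z i := Function.ne_iff.mp hyz
    exact prod_eq_zero (mem_univ i) (if_neg hi')

include hk in
/-- **★★ BIORTHOGONALITY**: `segIter k (S1 k A) = A` — the `k`-fold transported-segment mean of the spread of a coarse 1-form returns the 1-form EXACTLY (flat formula, product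
structure of the block, `Ptau_seg` in the run direction, `Psig_cell` across). [cite: Balaban1987RG1, (0.4)+(0.11) p.253] -/
theorem segIter_S1 (A : PBond P k → ℝ) : segIter k (S1 k A) = A := by
  funext c
  obtain ⟨z, μ⟩ := c
  rw [segIter_apply (S1 k A) k hk z μ]
  simp_rw [runSum_S1]
  rw [sum_comm]
  simp_rw [← mul_sum]
  simp_rw [blockSum_profiles k hk z _ μ, mul_ite, mul_zero]
  rw [sum_ite_eq']
  simp only [mem_univ, if_true]
  rw [show (side (hh P k) : ℝ) = (P.L : ℝ) ^ k by rw [hside]; push_cast; ring]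
  have hn : (0 : ℝ) < ((P.L : ℝ) ^ k) ^ P.d := pow_pos (pow_pos (Nat.cast_pos.mpr P.L_pos) _) _
  field_simp

end Summit.QuantumFields.YangMills.Theorems.LinearLiftSpread

end
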